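import Literature.AnabelianGeometry.SemiGraphs.TemperedFunctorialityHomClause1
import Literature.AnabelianGeometry.SemiGraphs.TemperedFunctorialitySlimProofs
import HarnessLib

/-!
# [SemiAnbd] Proposition 3.6 (iv) (`InducedHomOfMorphism`): the assembly of both clauses

Mochizuki, *Semi-graphs of anabelioids*, Publ. RIMS **42** (2006), §3, Proposition 3.6 (iv),
manuscript p. 39 [cite: MochizukiSemiAnbd2006, Prop 3.6(iv) p.39]: "Any morphism of semi-graphs of
anabelioids `G' → G` induces a morphism of temperoids `B^temp(G') → B^temp(G)` … Moreover, if the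
original morphism … is locally open, then this morphism of temperoids is relatively temp-slim."

PROOF-ONLY assembly of abc-iut-L3-t2's named fact `ProfiniteSemiGraph.InducedHomOfMorphism`
(`TemperedVerticial.lean`) from the two clauses now in the tree: clause 1 unconditionally
(`Hom.InducedHomOfMorphism_clause1`: the pull-back functor `B^temp(G) → B^temp(G')` of
`TemperedFunctorialityProofs/ExactProofs/HomProofs.lean` is a morphism of temperoids, Proposition 3.2
(`TemperoidHomEqRes_holds`, seat abc-iut-L3-d2) turns it into a continuous homomorphism compatible
with the verticial homomorphisms; refiled by seat abc-iut-L6-d4) and clause 2 as the reduction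
`InducedHomOfMorphism_clause2_of` (seat abc-iut-L3-t6, cell ruling η2) to the residual
`VerticialHomRelativelyTempSlim` ("the verticial homomorphisms are relatively temp-slim", the
tempered Corollary 2.7 (ii) at one vertex; discharged from Theorem 3.7 (ii)'s same-vertex clause by
seat abc-iut-L3-t8).  Result: `inducedHomOfMorphism_of_slim` — `InducedHomOfMorphism` from that
residual for all charts of all `𝒢` satisfying the hypotheses of Proposition 3.6.  Nothing here takes
a side on [IUTchIII] Cor. 3.12.
-/

namespace Literature.AnabelianGeometry.SemiGraphs

namespace ProfiniteSemiGraph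

universe u

/-- **[SemiAnbd] Proposition 3.6 (iv) (`InducedHomOfMorphism`) REDUCED to the residual
`VerticialHomRelativelyTempSlim`** ("the verticial homomorphisms `π̂₁(G_v) → π₁^temp(G)` are
relatively temp-slim", for every `𝒢` satisfying the hypotheses of Prop. 3.6 and every chart): the
continuous homomorphism of clause 1 (unconditional) is relatively temp-slim for locally open `F` by
clause 2's reduction. [cite: MochizukiSemiAnbd2006, Prop 3.6(iv) p.39] -/
theorem inducedHomOfMorphism_of_slim
    (hslim : ∀ (𝒢 : ProfiniteSemiGraph.{u}), 𝒢.Prop36Hypotheses → ∀ c : TemperedPiChart 𝒢,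
      VerticialHomRelativelyTempSlim 𝒢 c) :
    InducedHomOfMorphism.{u} := by
  intro 𝒢' 𝒢 h𝒢' h𝒢 F c' c
  obtain ⟨φ, hφ⟩ := F.InducedHomOfMorphism_clause1 c' c
  exact ⟨φ, hφ, fun hF =>
    InducedHomOfMorphism_clause2_of h𝒢' F hF c' c φ hφ (hslim 𝒢' h𝒢' c') (hslim 𝒢 h𝒢 c)⟩

end ProfiniteSemiGraph

end Literature.AnabelianGeometry.SemiGraphs
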